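import Literature.NumberTheory.EllipticCurves.TwoDescentLinearConditions
import HarnessLib

/-!
# Rank-2 observatory — the complete `2`-descent frame when a `2`-torsion point is divisible by `2`

HONEST FRAMING: per-curve certified theorems and census instruments; no claim on BSD in rank ≥ 2.

The frame of Literature `TwoDescentLinearConditions.lean` (`mordellWeilRank_le_of_linear_conditions`,
`le_mordellWeilRank_of_twoTorsion'`; Silverman AEC Prop. X.1.4 with the Mordell–Weil theorem) uses
the `2`-torsion points `T₁, T₂` as the torsion witnesses of `#E(ℚ)/2E(ℚ) ≥ 2^{r+2}`. That needs
`T₂ ∉ 2E(ℚ)`, which fails exactly when `E(ℚ)_tors ⊋ E[2]`, e.g. for the census rows with torsion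
`ℤ/2 × ℤ/4`, where `T₂ = 2T₄`. The counting lemma `pow_finrank_add_two_le_natCard_range`
(Literature `TwoDescentRankBounds.lean`) already allows ARBITRARY finite-order witnesses, so the
upper bound goes through verbatim with `(T₁, T₄)` (`mordellWeilRank_le_of_linear_conditions_tors`,
cf. Literature `Curve15A1Descent.finite_point`); the lower bound needs one more halving step in the
descent (`linearIndependent_of_torsion_two_four`: a relation `Σ gᵢ Pᵢ = b·T₄` forces, applying
`ψ`, all `gᵢ` and `b` even; halving lands in `E[2] = {O, T₁, 2T₄, T₁ + 2T₄}`; the two classes with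
`ψ`-value `ψ T₁` are excluded by applying `ψ` once more, the other two are relations of the same
shape with smaller `Σ |gᵢ|`), packaged for curves as `le_mordellWeilRank_of_twoTorsion_four`
(`2T₄ = T₂`, `ψ T₃ = ψ T₁`). Plus the finite order of such a `T₄`
(`isOfFinAddOrder_of_add_self_eq_twoTorsion`). Everything is proved; no named facts, no `sorry`.

## References

* J. H. Silverman, *The Arithmetic of Elliptic Curves*, 2nd ed., GTM 106 (2009), Prop. X.1.4,
  Thm. VIII.6.7. [SilvermanAEC2009]
* J. E. Cremona, *Algorithms for Modular Elliptic Curves*, 2nd ed. (1997), Sec. 3.6 (the `2`-descent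
  via `2`-isogeny / rational `2`-torsion as implemented in `mwrank`). [CremonaAlgorithms1997]
-/

-- single-conjunct summit: `Summit.BirchSwinnertonDyer.BirchSwinnertonDyer.…` repeats the name by design
set_option linter.dupNamespace false

noncomputable section

namespace Summit.BirchSwinnertonDyer.BirchSwinnertonDyer.Rank2Observatory

open WeierstrassCurve WeierstrassCurve.Affine WeierstrassCurve.Affine.Point
open Literature.NumberTheory.EllipticCurves Literature.NumberTheory.EllipticCurves.KramerTwoDescent
open Literature.NumberTheory.EllipticCurves.TwoDescentLocal

/-- **Independence of points from the `2`-descent when `E[2] = {O, t₁, 2t₄, t₁ + 2t₄}`**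
(abstract form; Silverman AEC Prop. X.1.4 in use). Let `A` be an abelian group, `ψ : A → V`
additive into a `ℤ/2`-vector space, `t₁, t₄ ∈ A`, and suppose every `Q` with
`2Q = 0` is `0`, `2t₄`, or has `ψ Q = ψ t₁`. If the only `ℤ/2`-linear relation
`Σ cᵢ ψ(Pᵢ) + ε₁ ψ(t₁) + ε₂ ψ(t₄) = 0` is the trivial one, then `P₁, …, P_r` are `ℤ`-linearly
independent: a relation `Σ gᵢ Pᵢ = b·t₄` gives, applying `ψ`, all `gᵢ` and `b` even; halving,
`Q = Σ g'ᵢ Pᵢ - b'·t₄` has `2Q = 0`; `ψ Q = ψ t₁` is excluded by `ψ` again, and `Q ∈ {0, 2t₄}` is a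
relation of the same shape with smaller `Σ |gᵢ|`. [cite: SilvermanAEC2009, Prop. X.1.4] -/
theorem linearIndependent_of_torsion_two_four {A V : Type*} [AddCommGroup A] [AddCommGroup V]
    [Module (ZMod 2) V] (ψ : A →+ V) {r : ℕ} (P : Fin r → A) (t₁ t₄ : A)
    (hE2 : ∀ Q : A, (2 : ℕ) • Q = 0 → Q = 0 ∨ Q = (2 : ℕ) • t₄ ∨ ψ Q = ψ t₁)
    (hind : ∀ (c : Fin r → ZMod 2) (ε₁ ε₂ : ZMod 2),
      ∑ i, c i • ψ (P i) + ε₁ • ψ t₁ + ε₂ • ψ t₄ = 0 → c = 0 ∧ ε₁ = 0 ∧ ε₂ = 0) :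
    LinearIndependent ℤ P := by
  -- `ψ (Σ gᵢ Pᵢ) = Σ (gᵢ mod 2) ψ(Pᵢ)` and `ψ (b t₄) = (b mod 2) ψ t₄`
  have hψsum : ∀ g : Fin r → ℤ,
      ψ (∑ i, g i • P i) = ∑ i, ((g i : ℤ) : ZMod 2) • ψ (P i) := by
    intro g
    rw [map_sum]
    refine Finset.sum_congr rfl fun i _ => ?_
    rw [map_zsmul, Int.cast_smul_eq_zsmul]
  have hψb : ∀ b : ℤ, ψ (b • t₄) = ((b : ℤ) : ZMod 2) • ψ t₄ := fun b => by
    rw [map_zsmul, Int.cast_smul_eq_zsmul]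
  -- descent on `Σ |gᵢ|` over the relations `Σ gᵢ Pᵢ = b • t₄`
  suffices key : ∀ (N : ℕ) (g : Fin r → ℤ) (b : ℤ), ∑ i, (g i).natAbs ≤ N →
      ∑ i, g i • P i = b • t₄ → ∀ i, g i = 0 by
    rw [Fintype.linearIndependent_iff]
    exact fun g hg => key _ g 0 le_rfl (by rw [hg, zero_zsmul])
  intro N
  induction N with
  | zero =>
    intro g b hN _ i
    have := (Finset.sum_eq_zero_iff_of_nonneg fun i _ => Nat.zero_le _).mp (Nat.le_zero.mp hN)
      i (Finset.mem_univ i)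
    exact Int.natAbs_eq_zero.mp this
  | succ N ih =>
    intro g b hN hg
    by_contra hne
    obtain ⟨j, hj⟩ : ∃ j, g j ≠ 0 := not_forall.mp hne
    -- applying `ψ`: all `gᵢ` and `b` are even
    have hrel : ∑ i, ((g i : ℤ) : ZMod 2) • ψ (P i) + (0 : ZMod 2) • ψ t₁ +
        ((b : ℤ) : ZMod 2) • ψ t₄ = 0 := by
      rw [← hψsum, hg, hψb, zero_smul, add_zero, ZModModule.add_self]
    obtain ⟨hc, -, hb⟩ := hind _ _ _ hrel
    have heven : ∀ i, (2 : ℤ) ∣ g i := fun i => by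
      have hi := congrFun hc i
      simp only [Pi.zero_apply] at hi
      exact (ZMod.intCast_zmod_eq_zero_iff_dvd (g i) 2).mp hi
    have hbeven : (2 : ℤ) ∣ b := (ZMod.intCast_zmod_eq_zero_iff_dvd b 2).mp hb
    choose g' hg' using heven
    obtain ⟨b', hb'⟩ := hbeven
    -- `Q := Σ g'ᵢ Pᵢ - b' t₄` has `2Q = 0`
    have hsum2 : (2 : ℕ) • ∑ i, g' i • P i = ∑ i, g i • P i := by
      rw [Finset.smul_sum]
      refine Finset.sum_congr rfl fun i _ => ?_
      rw [hg' i, mul_zsmul, ofNat_zsmul]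
    have hb2 : (2 : ℕ) • (b' • t₄) = b • t₄ := by rw [hb', mul_zsmul, ofNat_zsmul]
    have h2Q : (2 : ℕ) • (∑ i, g' i • P i - b' • t₄) = 0 := by
      rw [nsmul_sub, hsum2, hb2, hg, sub_self]
    -- the descent measure drops
    have hlt : ∑ i, (g' i).natAbs < ∑ i, (g i).natAbs := by
      have hle : ∀ i, (g' i).natAbs ≤ (g i).natAbs := fun i => by
        rw [hg' i, Int.natAbs_mul]
        exact Nat.le_mul_of_pos_left _ (by norm_num)
      have hj' : (g' j).natAbs < (g j).natAbs := by
        have hgj : g' j ≠ 0 := fun h0' => hj (by rw [hg' j, h0', mul_zero])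
        rw [hg' j, Int.natAbs_mul, show (2 : ℤ).natAbs = 2 from rfl]
        have : 0 < (g' j).natAbs := Int.natAbs_pos.mpr hgj
        omega
      exact Finset.sum_lt_sum (fun i _ => hle i) ⟨j, Finset.mem_univ j, hj'⟩
    have hN' : ∑ i, (g' i).natAbs ≤ N := by omega
    rcases hE2 _ h2Q with h0 | h0 | h0
    · -- `Σ g'ᵢ Pᵢ = b' t₄`: descend
      have hzero := ih g' b' hN' (sub_eq_zero.mp h0)
      exact hj (by rw [hg' j, hzero j, mul_zero])
    · -- `Σ g'ᵢ Pᵢ = (b' + 2) t₄`: descend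
      have hrel' : ∑ i, g' i • P i = (b' + 2) • t₄ := by
        rw [sub_eq_iff_eq_add] at h0
        rw [h0, add_zsmul, ofNat_zsmul, add_comm]
      have hzero := ih g' (b' + 2) hN' hrel'
      exact hj (by rw [hg' j, hzero j, mul_zero])
    · -- `ψ Q = ψ t₁`: excluded by the independence of `ψ t₁`
      have hrel' : ∑ i, ((g' i : ℤ) : ZMod 2) • ψ (P i) + (1 : ZMod 2) • ψ t₁ +
          ((b' : ℤ) : ZMod 2) • ψ t₄ = 0 := by
        rw [map_sub, hψsum, hψb, ZModModule.sub_eq_add] at h0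
        rw [one_smul, add_right_comm, h0, ZModModule.add_self]
      exact one_ne_zero (hind _ _ _ hrel').2.1

/-- **Lower bound with torsion `ℤ/2 × ℤ/4`** (Silverman AEC Prop. X.1.4 made honest by
Mordell–Weil, tree `module_finite_point_holds`), for an arbitrary `DecidableEq` instance on the
base field: let `E` have rational `2`-torsion `T₁, T₂, T₃` with `T₂ = 2T₄` for a rational point
`T₄`, and let `ψ : E(K) → V` be additive into a `ℤ/2`-vector space with `ψ T₃ = ψ T₁`. If the values
`ψ P₁, …, ψ P_r, ψ T₁, ψ T₄` are `ℤ/2`-linearly independent then `r ≤ rk E(K)`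
(`E[2] = {O, T₁, T₂, T₃}`, tree `eq_zero_or_eq_twoTorsion_of_two_nsmul_eq_zero`, feeds
`linearIndependent_of_torsion_two_four`). [cite: SilvermanAEC2009, Prop. X.1.4] -/
theorem le_mordellWeilRank_of_twoTorsion_four {K : Type*} [Field K] [NumberField K]
    [inst : DecidableEq K] {W : WeierstrassCurve K} [W.IsElliptic] {e₁ e₂ e₃ : K}
    (h : W.toAffine.SplitTwoTorsion e₁ e₂ e₃) {V : Type*} [AddCommGroup V] [Module (ZMod 2) V]
    (ψ : W.toAffine.Point →+ V) {r : ℕ} (P : Fin r → W.toAffine.Point) (T₄ : W.toAffine.Point)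
    (hT₄ : (2 : ℕ) • T₄ = .some e₂ _ (nonsingular_twoTorsion h.swap₁₂))
    (h₃ : ψ (.some e₃ _ (nonsingular_twoTorsion h.swap₂₃.swap₁₂)) =
      ψ (.some e₁ _ (nonsingular_twoTorsion h)))
    (hind : ∀ (c : Fin r → ZMod 2) (ε₁ ε₂ : ZMod 2),
      ∑ i, c i • ψ (P i) + ε₁ • ψ (.some e₁ _ (nonsingular_twoTorsion h)) + ε₂ • ψ T₄ = 0 →
        c = 0 ∧ ε₁ = 0 ∧ ε₂ = 0) :
    r ≤ W.mordellWeilRank := by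
  have e : inst = fun a b => Classical.propDecidable (a = b) := Subsingleton.elim _ _
  subst e
  letI : DecidableEq K := fun a b => Classical.propDecidable (a = b)
  haveI : Module.Finite ℤ W.toAffine.Point := W.module_finite_point_holds
  have hE2 : ∀ Q : W.toAffine.Point, (2 : ℕ) • Q = 0 →
      Q = 0 ∨ Q = (2 : ℕ) • T₄ ∨ ψ Q = ψ (.some e₁ _ (nonsingular_twoTorsion h)) := by
    intro Q hQ
    rcases eq_zero_or_eq_twoTorsion_of_two_nsmul_eq_zero h hQ with h0 | h0 | h0 | h0
    · exact Or.inl h0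
    · exact Or.inr (Or.inr (by rw [h0]))
    · exact Or.inr (Or.inl (h0.trans hT₄.symm))
    · exact Or.inr (Or.inr (by rw [h0, h₃]))
  have hli := (linearIndependent_of_torsion_two_four ψ P _ T₄ hE2 hind).fintype_card_le_finrank
  rw [Fintype.card_fin] at hli
  unfold WeierstrassCurve.mordellWeilRank
  exact hli

/-- **Upper bound with arbitrary torsion witnesses** (Silverman AEC Prop. X.1.4 with the
Mordell–Weil theorem; the frame `mordellWeilRank_le_of_linear_conditions` with `T₁, T₂` replaced by
any two points `t₁, t₂` of finite order that `ψ` separates — for torsion `ℤ/2 × ℤ/4` one takes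
`t₁ = T₁`, `t₂ = T₄`): if `ψ : E(K) → (ℤ/2)^N` detects the `2`-descent class, `κ ∘ ψ = 0` with
`κ : (ℤ/2)^N ↠ (ℤ/2)^k`, and `ψ t₁, ψ t₂, ψ (t₁ + t₂) ≠ 0`, `ψ t₁ ≠ ψ t₂`, then
`2^{r+2} ≤ #ψ(E(K)) ≤ 2^{N-k}`, so `r ≤ N - k - 2` (tree `pow_finrank_add_two_le_natCard_range`).
[cite: SilvermanAEC2009, Prop. X.1.4] -/
theorem mordellWeilRank_le_of_linear_conditions_tors {K : Type*} [Field K] [NumberField K]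
    [inst : DecidableEq K] {W : WeierstrassCurve K} [W.IsElliptic]
    {e₁ e₂ e₃ : K} (h : W.toAffine.SplitTwoTorsion e₁ e₂ e₃) {N k s : ℕ} (hN : N = k + (s + 2))
    (ψ : W.toAffine.Point →+ (Fin N → ZMod 2)) (κ : (Fin N → ZMod 2) →+ (Fin k → ZMod 2))
    (hker : ∀ P, ψ P = 0 → twoDescentMap h P = 0) (hkill : ∀ P, κ (ψ P) = 0)
    (hκ : Function.Surjective κ) {t₁ t₂ : W.toAffine.Point} (ht₁ : IsOfFinAddOrder t₁)
    (ht₂ : IsOfFinAddOrder t₂) (h₁ : ψ t₁ ≠ 0) (h₂ : ψ t₂ ≠ 0) (h₃ : ψ (t₁ + t₂) ≠ 0)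
    (h₁₂ : ψ t₁ ≠ ψ t₂) :
    W.mordellWeilRank ≤ s := by
  -- the group law behind `mordellWeilRank` is elaborated against the classical instance
  have e : inst = fun a b => Classical.propDecidable (a = b) := Subsingleton.elim _ _
  subst e
  letI : DecidableEq K := fun a b => Classical.propDecidable (a = b)
  haveI : Module.Finite ℤ W.toAffine.Point := W.module_finite_point_holds
  have hker' : ∀ a, ψ a = 0 → ∃ b, a = 2 • b := fun a ha => by
    have ha' : a ∈ (twoDescentMap h).ker := hker a ha
    rw [ker_twoDescentMap h] at ha'
    obtain ⟨b, hb⟩ := ha'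
    exact ⟨b, hb.symm⟩
  have hbound := pow_finrank_add_two_le_natCard_range ψ hker' ht₁ ht₂ h₁ h₂ h₃ h₁₂
  have hle : ψ.range ≤ κ.ker := by
    rintro _ ⟨P, rfl⟩
    exact hkill P
  have hcard : Nat.card ψ.range ≤ Nat.card κ.ker := AddSubgroup.card_le_of_le hle
  have hkerc := natCard_ker_of_surjective κ hκ
  have key : 2 ^ (Module.finrank ℤ W.toAffine.Point + 2) * 2 ^ k ≤ 2 ^ N := by
    rw [← hkerc]; exact Nat.mul_le_mul_right _ (hbound.trans hcard)
  rw [← pow_add, hN] at key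
  have := (Nat.pow_le_pow_iff_right (by norm_num)).mp key
  unfold WeierstrassCurve.mordellWeilRank
  omega

/-- A point `T` with `T + T = T₂` (a rational `2`-torsion point) has finite order (`4T = 2T₂ = O`,
tree `two_nsmul_twoTorsion`). [folklore] -/
theorem isOfFinAddOrder_of_add_self_eq_twoTorsion {F : Type*} [Field F] [DecidableEq F]
    [CharZero F] {W : Affine F} [W.IsElliptic] {e₁ e₂ e₃ : F} (h : W.SplitTwoTorsion e₁ e₂ e₃)
    {T : W.Point} (hT : T + T = .some e₂ _ (nonsingular_twoTorsion h.swap₁₂)) :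
    IsOfFinAddOrder T := by
  refine isOfFinAddOrder_iff_nsmul_eq_zero.mpr ⟨4, by norm_num, ?_⟩
  have h4 : (4 : ℕ) • T = (2 : ℕ) • (T + T) := by abel
  rw [h4, hT]
  exact two_nsmul_twoTorsion h.swap₁₂

/-- … and `2T = T₂` in the `ℕ`-scalar form used by `le_mordellWeilRank_of_twoTorsion_four`. [folklore] -/
theorem two_nsmul_eq_of_add_self {F : Type*} [Field F] [DecidableEq F]
    [CharZero F] {W : Affine F} [W.IsElliptic] {e₁ e₂ e₃ : F} (h : W.SplitTwoTorsion e₁ e₂ e₃)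
    {T : W.Point} (hT : T + T = .some e₂ _ (nonsingular_twoTorsion h.swap₁₂)) :
    (2 : ℕ) • T = .some e₂ _ (nonsingular_twoTorsion h.swap₁₂) := by
  rw [two_nsmul, hT]

end Summit.BirchSwinnertonDyer.BirchSwinnertonDyer.Rank2Observatory

end
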